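import Summits.MatrixMultiplication.OmegaCensus.SmallFormats.GF2FastLeaf
import HarnessLib

/-!
# ω-census family (a), GF(2) rank floors: FAST replay of LP-DFS rounds, part 4 (splitting one tree replay over the children of a node)

HONEST FRAMING (cell `pub-mm22`, seat p3 g4; v4 kernel-upgrade items (0′)/(C)). Checker PLUMBING, PROVED (0 sorry); no bound
is claimed here. The fast list-path replay `MCert.checkL` (`GF2FastLeaf.lean`) of ONE root tree of an LP-DFS round is a single
`decide +kernel`; for the larger lift certificates of the cell's cascade (e.g. orbit 441: a root with 778 LP leaves / 5,728
rows) one kernel evaluation exceeds the memory budget. `checkL_of_kids` splits a node's replay into facts about ranges of its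
children (`kidOfM`, `GF2OrbitSweepLPSplit.lean`), glued by `allRange_append` (`GF2FastLB.lean`); `allRange_one_of` turns the
separately assembled replay of one (big) child back into a one-element range. Recursion over depth gives arbitrarily fine splits
without restating any tree data.
-/

namespace Summit.MatrixMultiplication.OmegaCensus.GF2RankLB

/-- **Splitting a node's fast replay over its children**: the node is internal, its depth is below `maxDepth`, and every
child from the path maximum on passes with the extended path (as ONE `allRange` fact, however it was glued together). The
range bounds are explicit numerals (`e₁`, `e₂` by `rfl`/`decide`). -/
theorem checkL_of_kids {N : ℕ} {LBm : ℕ → ℕ} {target maxDepth d : ℕ} {pl : List ℕ} (t : MCert N) {lo n : ℕ}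
    (ht : isNodeBM t = true) (hd : Nat.blt d maxDepth = true) (e₁ : maxL pl = lo) (e₂ : N - lo = n)
    (h : allRange (fun m => if hm : m < N then (kidOfM t ⟨m, hm⟩).checkL LBm target maxDepth (d + 1) (pl ++ [m]) else true)
      lo n = true) :
    t.checkL LBm target maxDepth d pl = true := by
  cases t with
  | leaf rows D => simp [isNodeBM] at ht
  | node cs =>
    subst e₁ e₂
    unfold MCert.checkL
    rw [Bool.and_eq_true]
    exact ⟨hd, h⟩

/-- One child, replayed separately, as a one-element range. -/
theorem allRange_one_of {N : ℕ} {LBm : ℕ → ℕ} {target maxDepth d : ℕ} {pl : List ℕ} (t : MCert N) (j : ℕ) (hj : j < N)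
    (h : (kidOfM t ⟨j, hj⟩).checkL LBm target maxDepth (d + 1) (pl ++ [j]) = true) :
    allRange (fun m => if hm : m < N then (kidOfM t ⟨m, hm⟩).checkL LBm target maxDepth (d + 1) (pl ++ [m]) else true)
      j 1 = true := by
  rw [allRange, allRange, Bool.and_true, dif_pos hj]
  exact h

/-- A root of the family, replayed through `checkL_of_kids`, in the `fastRootL` form of `rootsOKX_dfsLP_of_fastL`. -/
theorem fastRootL_of_checkL {N : ℕ} (roots : Fin N → MCert N) (LBm : ℕ → ℕ) (target k : ℕ) (hk : k < N)
    (h : (roots ⟨k, hk⟩).checkL LBm target (target - 1) 1 [k] = true) : fastRootL roots LBm target k = true := by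
  unfold fastRootL
  rw [dif_pos hk]
  exact h

end Summit.MatrixMultiplication.OmegaCensus.GF2RankLB
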